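import Literature.NumberTheory.GaloisCohomology.Howard2004.ConjugationTwistTransferProofs
import Literature.NumberTheory.GaloisCohomology.Howard2004.DualityDatumLocalCupScalarReadingProofs
import Literature.NumberTheory.GaloisCohomology.Howard2004.LocalTwoDetectsFiniteProofs
import Literature.NumberTheory.GaloisCohomology.Howard2004.CohomologyMapBijectiveTransportProofs
import Literature.NumberTheory.GaloisCohomology.Howard2004.TransportConnectingKernelProofs
import Literature.NumberTheory.GaloisCohomology.Howard2004.IsotropyDescentProofs
import Literature.NumberTheory.GaloisCohomology.Howard2004.RelaxedSelmerIsotropyProofs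
import Literature.NumberTheory.GaloisCohomology.PoitouTateSelmerStructures
import HarnessLib

/-!
# Howard 2004, H.4 read through a Frobenius character: the local condition transported and dualised IS the dual local
# condition, and the conjugation transfer `Ψ = Θ_* ∘ Tw` identifies `H¹_𝓕(K, T)` with `H¹_{𝓕^*}(K, T^∨(1))` (theorems only)

Topic `NumberTheory/GaloisCohomology/Howard2004`. THEOREMS ONLY: no definition, no named fact, no instance, no notation,
no `sorry`.  Cell `pub/bsd-print-x9` (seat x10b-p1-w7 g12, brick «C451-CL Q4, slice 2 = LOCAL MATCH», plan of
`bsd-line-x10b-p1` LEAD g14 2026-08-29T14:13Z; `--supports stmt-BirchSwinnertonDyer-22642`).  Sequel of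
`ConjugationTwistTransferProofs` (slice 1: the transfer `Ψ` along a `τ`-semilinear `Θ`) and of the tree's bridge
`DualityDatumTateDualBridge` (`Θ = D.toTateDual λ exp : Tw(T) → T^∨(1)`, `H²(exp∘λ)(x ∪_e y) = ⟨x, Θ_* y⟩_{Tate}`).

SOURCE. B. Howard, *The Heegner point Kolyvagin system*, Compositio Math. **140** (2004) = arXiv:1202.6340, §1.3 H.4 (p. 7
L69–82: «we assume that the local condition `𝓕` is its own exact orthogonal complement under the induced local pairing
`⟨ , ⟩_v : H¹(K_v, T) × H¹(K_v̄, T) → R`»), Def. 1.1.6 (the dual local condition `𝓕^*` on `T^* = Hom(T, R(1))`), and the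
proof of Thm. 1.4.2 (p0008 L120–124: «Using hypothesis H.4 […] we may identify `H¹_{𝓕*}(K, T*[𝔪]) ≅ H¹_𝓕(K, T[𝔪])`»).

WHAT IS PROVED, for a duality datum `D` on `(T, ρ)` over a FINITE coefficient ring `R` killed by `p^k`, a FROBENIUS reading
`λ : R → ℤ/p^k` (every additive character is `λ(b ·)`), a bijective trivialisation `exp` of `μ_{p^k}`, `Θ := D.toTateDual λ exp`
bijective, a Selmer structure `𝓕` with H.4 (`D.IsSelfOrthogonal 𝓕`) whose local conditions are `R`-submodules, and a family of
local invariants `inv` injective at the finite places: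
* §1 **`map_toTateDual_transportH1_eq_dualLocalCondition`** — at every finite `v`,
  `Θ_*(transport_v 𝓕_{σ v}) = 𝓕_v^*` (`inv.dualLocalCondition`): `⊆` by the bridge and the isotropy half of H.4; `⊇` by the
  readings `λ_b` (`localCup_scalarMapH1_left`, `cohomologyMap_expLam_scalarMap_two`), the detection
  `eq_zero_of_forall_cohomologyMap_expLam_eq_zero_of_finite` and the annihilator half of H.4.
* §2 **`conjTransfer_mem_dualSelmerGroup_iff`** / **`exists_addEquiv_selmerGroup_dualSelmerGroup`** — the transfer `Ψ` of
  slice 1 for `Θ` restricts to an additive BIJECTION `H¹_𝓕(K, T) ≃ H¹_{𝓕^*}(K, T^∨(1))` (infinite places: `𝓕^*` total there,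
  e.g. `K` imaginary quadratic).

HONEST FRAMING: no pairing on Selmer groups is constructed; Prop. 1.4.1 / C45.1″ / Thm. 1.6.1 are NOT proved; no summit
statement is proved; the Birch–Swinnerton-Dyer conjecture is not proved by any of this.
-/

set_option autoImplicit false

noncomputable section

open Function NumberField IsDedekindDomain Field CategoryTheory
open scoped NumberField ContRepresentation

namespace Literature.NumberTheory.GaloisCohomology.Howard2004

open Literature.NumberTheory.GaloisRepresentations
open Literature.NumberTheory.GaloisRepresentations.DiscreteGaloisModule
open Literature.NumberTheory.GaloisCohomology (LocalInvariants)


namespace DualityDatum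

variable {K : Type} [Field K] [NumberField K] {M : Type} [AddCommGroup M] [TopologicalSpace M]
  [DiscreteTopology M] [Finite M] {R : Type} [CommRing R] [Module R M] [TopologicalSpace R] [DiscreteTopology R]
  {p : ℕ} [Fact p.Prime] [Algebra ℤ_[p] R] {cd : ConjugationDatum K} {ρ : DiscreteGaloisModule K M}
  (D : DualityDatum p cd ρ R) {k : ℕ}
  (lam : R →+ ZMod (p ^ k))
  (hlam : ∀ (z : ℤ_[p]) (r : R), lam (algebraMap ℤ_[p] R z * r) = PadicInt.toZModPow k z * lam r)
  (exp : ZMod (p ^ k) →+ MuCarrier K (p ^ k))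
  (hexp : ∀ (g : absoluteGaloisGroup K) (x : ZMod (p ^ k)),
    exp (cyclotomicCharacterModPow K p k g * x) = mu K (p ^ k) g (exp x))

/-! ## §0 `Θ` as a `τ`-semilinear additive map; the two spellings of `H¹(K_v, Θ)` -/

/-- `Θ = toTateDual` is `τ`-semilinear from `ρ` to `ρ^∨(1)`: `Θ(ρ(g^τ) m) = g · Θ(m)`.
[cite: Howard2004HeegnerKolyvagin, §1.3 H.4 (arXiv:1202.6340 p. 7 L69–80)] -/
theorem toTateDual_semilinear (g : absoluteGaloisGroup K) (m : M) :
    (D.toTateDual lam hlam exp hexp).toContinuousLinearMap.toLinearMap.toAddMonoidHom (ρ (cd.conj g) m) =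
      (ρ.tateDual (p ^ k)) g
        ((D.toTateDual lam hlam exp hexp).toContinuousLinearMap.toLinearMap.toAddMonoidHom m) := by
  have h := (D.toTateDual lam hlam exp hexp).isIntertwining g m
  simp only [ContinuousRep.toContRepresentation_apply_apply, ConjugationDatum.twist_apply] at h
  exact h

/-- The bridge's spelling `galoisCohomology.map (localMap Θ v) 1` of `H¹(K_v, Θ)` agrees with the transfer file's
`ContinuousRep.cohomologyMap … Θ … 1` (both are Mathlib's `ContinuousCohomology.map` along the identity of `Γ_{K_v}`).
[cite: SerreGaloisCohomology1997, I §2.2] -/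
theorem map_localMap_toTateDual_eq_cohomologyMap (v : Place K)
    (y : galoisCohomology ((cd.twist ρ).toLocal v) 1) :
    galoisCohomology.map (Literature.NumberTheory.EllipticCurves.DiscreteGaloisModule.localMap
        (D.toTateDual lam hlam exp hexp) v) 1 y =
      ContinuousRep.cohomologyMap ((cd.twist ρ).toLocal v) ((ρ.tateDual (p ^ k)).toLocal v)
        (D.toTateDual lam hlam exp hexp).toContinuousLinearMap.toLinearMap.toAddMonoidHom
        continuous_of_discreteTopology
        (twist_semilinear_equivariant_toLocal cd ρ (ρ.tateDual (p ^ k)) _ (D.toTateDual_semilinear lam hlam exp hexp) v)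
        1 y := by
  obtain ⟨χ, rfl⟩ := oneCocycleClass_surjective _ y
  rw [cohomologyMap_one_oneCocycleClass]
  exact map_oneCocycleClass _ _ _ χ

/-! ## §1 The local match: `Θ_*(transport_v 𝓕_{σ v}) = 𝓕_v^*` -/

/-- **`⊆`: the transported classes of `𝓕_{σ v}`, dualised, annihilate `𝓕_v`** — the isotropy half of H.4 read through the
bridge `H²(exp∘λ)(x ∪_e y) = ⟨x, Θ_* y⟩` and `inv_v`. [cite: Howard2004HeegnerKolyvagin, §1.3 H.4 (arXiv:1202.6340 p. 7 L78–82) and Def. 1.1.6] -/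
theorem map_toTateDual_transportH1_le_dualLocalCondition (𝓕 : SelmerStructure ρ) (hso : D.IsSelfOrthogonal 𝓕)
    (inv : LocalInvariants K (p ^ k)) (v : HeightOneSpectrum (𝓞 K)) :
    (𝓕 (Sum.inr (cd.σ • v))).map
        ((ContinuousRep.cohomologyMap ((cd.twist ρ).toLocal (Sum.inr v)) ((ρ.tateDual (p ^ k)).toLocal (Sum.inr v))
            (D.toTateDual lam hlam exp hexp).toContinuousLinearMap.toLinearMap.toAddMonoidHom
            continuous_of_discreteTopology
            (twist_semilinear_equivariant_toLocal cd ρ (ρ.tateDual (p ^ k)) _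
              (D.toTateDual_semilinear lam hlam exp hexp) (Sum.inr v)) 1).comp
          (cd.transportH1 ρ v)) ≤
      inv.dualLocalCondition ρ (Sum.inr v) (𝓕 (Sum.inr v)) := by
  rintro _ ⟨y, hy, rfl⟩
  refine (LocalInvariants.mem_dualLocalCondition_iff _ _ _ _ _).mpr fun a ha => ?_
  -- in the bridge's spelling: `⟨a, Θ_*(transport y)⟩ = H²(exp λ)(a ∪_e transport y) = H²(exp λ)(0) = 0`
  have key : localTatePairing ρ (p ^ k) (Sum.inr v) a
      (galoisCohomology.map (Literature.NumberTheory.EllipticCurves.DiscreteGaloisModule.localMap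
        (D.toTateDual lam hlam exp hexp) (Sum.inr v)) 1 (cd.transportH1 ρ v y)) = 0 :=
    D.localTatePairing_eq_zero_of_localCup_eq_zero lam hlam exp hexp (Sum.inr v)
      (IsSelfOrthogonalAt.localCup_eq_zero (hso v) ha ⟨y, hy, rfl⟩)
  have e := D.map_localMap_toTateDual_eq_cohomologyMap lam hlam exp hexp (Sum.inr v) (cd.transportH1 ρ v y)
  exact (congrArg (fun w => inv (Sum.inr v) (localTatePairing ρ (p ^ k) (Sum.inr v) a w)) e).symm.trans
    ((congrArg (inv (Sum.inr v)) key).trans (map_zero _))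

/-- **`⊇`: every class of `𝓕_v^*` is `Θ_*` of the transport of a class of `𝓕_{σ v}`** — `Θ_* ∘ transport_v` is onto
(`Θ` bijective, `transportH1_bijective`); a preimage pairs to zero with `𝓕_v` under EVERY reading `λ_b` of the induced
local pairing (`𝓕_v` is an `R`-submodule; `(b•a) ∪_e y = H²(b•)(a ∪_e y)`; `H²(exp∘λ) ∘ H²(b•) = H²(exp∘λ_b)`), hence under the
pairing itself (the readings `λ_b` exhaust the characters of the finite Frobenius ring `R`:
`eq_zero_of_forall_cohomologyMap_expLam_eq_zero_of_finite`), hence lies in `transport_v 𝓕_{σ v}` by the annihilator half of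
H.4. [cite: Howard2004HeegnerKolyvagin, §1.3 H.4 (arXiv:1202.6340 p. 7 L78–82) and Def. 1.1.6] [cite: MilneADT2006, Ch. I Cor. 2.3] -/
theorem dualLocalCondition_le_map_toTateDual_transportH1 [Finite R] (hρ : ρ.IsScalarLinear R)
    (hR : ∀ r : R, p ^ k • r = 0) (hexpb : Bijective exp)
    (hfrob : Bijective ((AddMonoidHom.mul : R →+ R →+ R).compr₂ lam))
    (hΘ : Bijective (D.toTateDual lam hlam exp hexp))
    (𝓕 : SelmerStructure ρ) (hso : D.IsSelfOrthogonal 𝓕)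
    (h𝓕R : ∀ (v : HeightOneSpectrum (𝓞 K)) (r : R) (x : galoisCohomology (ρ.toLocal (Sum.inr v)) 1),
      x ∈ 𝓕 (Sum.inr v) →
        galoisCohomology.scalarMapH1 (ρ.toLocal (Sum.inr v)) (isScalarLinear_toLocal hρ (Sum.inr v)) r x ∈ 𝓕 (Sum.inr v))
    (inv : LocalInvariants K (p ^ k)) (hinv : ∀ v : HeightOneSpectrum (𝓞 K), Injective (inv (Sum.inr v)))
    (v : HeightOneSpectrum (𝓞 K)) :
    inv.dualLocalCondition ρ (Sum.inr v) (𝓕 (Sum.inr v)) ≤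
      (𝓕 (Sum.inr (cd.σ • v))).map
        ((ContinuousRep.cohomologyMap ((cd.twist ρ).toLocal (Sum.inr v)) ((ρ.tateDual (p ^ k)).toLocal (Sum.inr v))
            (D.toTateDual lam hlam exp hexp).toContinuousLinearMap.toLinearMap.toAddMonoidHom
            continuous_of_discreteTopology
            (twist_semilinear_equivariant_toLocal cd ρ (ρ.tateDual (p ^ k)) _
              (D.toTateDual_semilinear lam hlam exp hexp) (Sum.inr v)) 1).comp
          (cd.transportH1 ρ v)) := by
  intro z hz
  -- `Θ_* ∘ transport_v` is onto
  have hsurj : Surjective (ContinuousRep.cohomologyMap ((cd.twist ρ).toLocal (Sum.inr v))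
      ((ρ.tateDual (p ^ k)).toLocal (Sum.inr v))
      (D.toTateDual lam hlam exp hexp).toContinuousLinearMap.toLinearMap.toAddMonoidHom continuous_of_discreteTopology
      (twist_semilinear_equivariant_toLocal cd ρ (ρ.tateDual (p ^ k)) _
        (D.toTateDual_semilinear lam hlam exp hexp) (Sum.inr v)) 1) :=
    (bijective_cohomologyMap_of_bijective _ _ _ _ hΘ).2
  obtain ⟨y', rfl⟩ := hsurj z
  obtain ⟨y, rfl⟩ := (cd.transportH1_bijective ρ v).2 y'
  -- the preimage `transport_v y` annihilates `𝓕_v` under `∪_e`, hence lies in `transport_v 𝓕_{σ v}` (H.4)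
  have hy : cd.transportH1 ρ v y ∈ (𝓕 (Sum.inr (cd.σ • v))).map (cd.transportH1 ρ v) := by
    refine ((hso v).2 (cd.transportH1 ρ v y)).mpr fun a ha => ?_
    refine D.eq_zero_of_forall_cohomologyMap_expLam_eq_zero_of_finite exp hexp hR hexpb v _ fun lam' hlam' => ?_
    obtain ⟨b, hb⟩ := hfrob.2 lam'
    subst hb
    have h1 := D.cohomologyMap_expLam_scalarMap_two lam hlam exp hexp (Sum.inr v) b
      (D.localCup (Sum.inr v) a (cd.transportH1 ρ v y))
    refine h1.symm.trans ?_
    rw [← D.localCup_scalarMapH1_left (Sum.inr v) (isScalarLinear_toLocal hρ (Sum.inr v)) b a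
        (cd.transportH1 ρ v y),
      D.cohomologyMap_localCup_eq_localTatePairing lam hlam exp hexp (Sum.inr v)]
    -- `⟨b•a, z⟩ = 0` (`z ∈ 𝓕_v^*`, `b•a ∈ 𝓕_v`), read in the bridge's spelling, then `inv_v` injective
    have hz' := (LocalInvariants.mem_dualLocalCondition_iff _ _ _ _ _).mp hz _ (h𝓕R v b a ha)
    have e := D.map_localMap_toTateDual_eq_cohomologyMap lam hlam exp hexp (Sum.inr v) (cd.transportH1 ρ v y)
    have hz'' : inv (Sum.inr v) (localTatePairing ρ (p ^ k) (Sum.inr v)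
        (galoisCohomology.scalarMapH1 (ρ.toLocal (Sum.inr v)) (isScalarLinear_toLocal hρ (Sum.inr v)) b a)
        (galoisCohomology.map (Literature.NumberTheory.EllipticCurves.DiscreteGaloisModule.localMap
          (D.toTateDual lam hlam exp hexp) (Sum.inr v)) 1 (cd.transportH1 ρ v y))) = 0 :=
      (congrArg (fun w => inv (Sum.inr v) (localTatePairing ρ (p ^ k) (Sum.inr v)
        (galoisCohomology.scalarMapH1 (ρ.toLocal (Sum.inr v)) (isScalarLinear_toLocal hρ (Sum.inr v)) b a) w)) e).trans
        hz'
    exact (injective_iff_map_eq_zero (inv (Sum.inr v))).mp (hinv v) _ hz''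
  obtain ⟨y₀, hy₀, he⟩ := hy
  exact ⟨y₀, hy₀, congrArg
    (ContinuousRep.cohomologyMap ((cd.twist ρ).toLocal (Sum.inr v)) ((ρ.tateDual (p ^ k)).toLocal (Sum.inr v))
            (D.toTateDual lam hlam exp hexp).toContinuousLinearMap.toLinearMap.toAddMonoidHom
            continuous_of_discreteTopology
            (twist_semilinear_equivariant_toLocal cd ρ (ρ.tateDual (p ^ k)) _
              (D.toTateDual_semilinear lam hlam exp hexp) (Sum.inr v)) 1) he⟩

/-- **THE LOCAL MATCH `Θ_*(transport_v 𝓕_{σ v}) = 𝓕_v^*`** at every finite place (H.4 for `𝓕` read through the Frobenius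
character `λ` and the trivialisation `exp`): the DUAL LOCAL CONDITION of `𝓕_v` for the local Tate pairing
(`inv.dualLocalCondition`, Howard Def. 1.1.6) is exactly the image of `𝓕_{σ v}` under Howard's transport
`H¹(K_{σ v}, T) ≅ H¹(K_v, Tw T)` followed by `Θ = toTateDual : Tw(T) → T^∨(1)` on `H¹(K_v, ·)`.
[cite: Howard2004HeegnerKolyvagin, §1.3 H.4 and Def. 1.1.6 (arXiv:1202.6340 p. 7 L69–82, p. 5)] [cite: MilneADT2006, Ch. I Cor. 2.3] -/
theorem map_toTateDual_transportH1_eq_dualLocalCondition [Finite R] (hρ : ρ.IsScalarLinear R)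
    (hR : ∀ r : R, p ^ k • r = 0) (hexpb : Bijective exp)
    (hfrob : Bijective ((AddMonoidHom.mul : R →+ R →+ R).compr₂ lam))
    (hΘ : Bijective (D.toTateDual lam hlam exp hexp))
    (𝓕 : SelmerStructure ρ) (hso : D.IsSelfOrthogonal 𝓕)
    (h𝓕R : ∀ (v : HeightOneSpectrum (𝓞 K)) (r : R) (x : galoisCohomology (ρ.toLocal (Sum.inr v)) 1),
      x ∈ 𝓕 (Sum.inr v) →
        galoisCohomology.scalarMapH1 (ρ.toLocal (Sum.inr v)) (isScalarLinear_toLocal hρ (Sum.inr v)) r x ∈ 𝓕 (Sum.inr v))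
    (inv : LocalInvariants K (p ^ k)) (hinv : ∀ v : HeightOneSpectrum (𝓞 K), Injective (inv (Sum.inr v)))
    (v : HeightOneSpectrum (𝓞 K)) :
    (𝓕 (Sum.inr (cd.σ • v))).map
        ((ContinuousRep.cohomologyMap ((cd.twist ρ).toLocal (Sum.inr v)) ((ρ.tateDual (p ^ k)).toLocal (Sum.inr v))
            (D.toTateDual lam hlam exp hexp).toContinuousLinearMap.toLinearMap.toAddMonoidHom
            continuous_of_discreteTopology
            (twist_semilinear_equivariant_toLocal cd ρ (ρ.tateDual (p ^ k)) _
              (D.toTateDual_semilinear lam hlam exp hexp) (Sum.inr v)) 1).comp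
          (cd.transportH1 ρ v)) =
      inv.dualLocalCondition ρ (Sum.inr v) (𝓕 (Sum.inr v)) :=
  le_antisymm (D.map_toTateDual_transportH1_le_dualLocalCondition lam hlam exp hexp 𝓕 hso inv v)
    (D.dualLocalCondition_le_map_toTateDual_transportH1 lam hlam exp hexp hρ hR hexpb hfrob hΘ 𝓕 hso h𝓕R inv hinv v)

/-! ## §2 The transfer identifies `H¹_𝓕(K, T)` with `H¹_{𝓕^*}(K, T^∨(1))` -/

/-- `(g^τ)^τ = g`. [folklore] -/
private theorem conj_conj' (cd : ConjugationDatum K) (g : absoluteGaloisGroup K) : cd.conj (cd.conj g) = g := by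
  have hinv : ∀ x, cd.τ (cd.τ x) = x := cd.involutive
  have hsymm : ∀ y, cd.τ.symm y = cd.τ y := fun y => by
    apply cd.τ.injective; rw [RingEquiv.apply_symm_apply, hinv]
  apply AlgEquiv.ext
  intro x
  change cd.τ.symm (cd.τ.symm ((show AlgebraicClosure K ≃ₐ[K] AlgebraicClosure K from g)
    (cd.τ (cd.τ x)))) = (show AlgebraicClosure K ≃ₐ[K] AlgebraicClosure K from g) x
  rw [hinv, hsymm, hsymm, hinv]

/-- **`Ψ(H¹_𝓕(K, T)) ⊆ H¹_{𝓕^*}(K, T^∨(1))`** for the transfer `Ψ` along `Θ = toTateDual` (cocycle formula `hΨ`), when `𝓕`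
satisfies H.4 and the dual structure is total at the infinite places (`K` imaginary quadratic: `H¹(K_∞, ·) = 0`).
[cite: Howard2004HeegnerKolyvagin, §1.3 H.4 and Thm. 1.4.2 proof (arXiv:1202.6340 p. 7 L69–82, p0008 L120–124)] -/
theorem conjTransfer_mem_dualSelmerGroup (𝓕 : SelmerStructure ρ) (hso : D.IsSelfOrthogonal 𝓕)
    (inv : LocalInvariants K (p ^ k))
    (hinf : ∀ (w : InfinitePlace K) (x : galoisCohomology ((ρ.tateDual (p ^ k)).toLocal (Sum.inl w)) 1),
      x ∈ inv.dualSelmerStructure ρ 𝓕 (Sum.inl w))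
    (Ψ : galoisCohomology ρ 1 →+ galoisCohomology (ρ.tateDual (p ^ k)) 1)
    (hΨ : ∀ (φ : contOneCocycles ρ.toTopRep) (ψ : contOneCocycles (ρ.tateDual (p ^ k)).toTopRep),
      (∀ g, ψ.1 g = (D.toTateDual lam hlam exp hexp).toContinuousLinearMap.toLinearMap.toAddMonoidHom (φ.1 (cd.conj g))) → Ψ (oneCocycleClass _ φ) = oneCocycleClass _ ψ)
    {c : galoisCohomology ρ 1} (hc : c ∈ 𝓕.selmerGroup) :
    Ψ c ∈ (inv.dualSelmerStructure ρ 𝓕).selmerGroup :=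
  conjTransfer_mem_selmerGroup cd ρ (ρ.tateDual (p ^ k)) _ (D.toTateDual_semilinear lam hlam exp hexp) Ψ hΨ 𝓕
    (inv.dualSelmerStructure ρ 𝓕)
    (fun v => D.map_toTateDual_transportH1_le_dualLocalCondition lam hlam exp hexp 𝓕 hso inv v) hinf hc

/-- **Every class of `H¹_{𝓕^*}(K, T^∨(1))` is `Ψ` of a class of `H¹_𝓕(K, T)`** (H.4 through the Frobenius reading; `σ² = 1`;
`𝓕` total at the infinite places). [cite: Howard2004HeegnerKolyvagin, §1.3 H.4 and Thm. 1.4.2 proof (arXiv:1202.6340 p. 7 L69–82, p0008 L120–124)] [cite: MilneADT2006, Ch. I Cor. 2.3] -/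
theorem exists_mem_selmerGroup_conjTransfer_eq [Finite R] (hρ : ρ.IsScalarLinear R)
    (hR : ∀ r : R, p ^ k • r = 0) (hexpb : Bijective exp)
    (hfrob : Bijective ((AddMonoidHom.mul : R →+ R →+ R).compr₂ lam))
    (hΘ : Bijective (D.toTateDual lam hlam exp hexp))
    (𝓕 : SelmerStructure ρ) (hso : D.IsSelfOrthogonal 𝓕)
    (h𝓕R : ∀ (v : HeightOneSpectrum (𝓞 K)) (r : R) (x : galoisCohomology (ρ.toLocal (Sum.inr v)) 1),
      x ∈ 𝓕 (Sum.inr v) →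
        galoisCohomology.scalarMapH1 (ρ.toLocal (Sum.inr v)) (isScalarLinear_toLocal hρ (Sum.inr v)) r x ∈ 𝓕 (Sum.inr v))
    (hinf𝓕 : ∀ (w : InfinitePlace K) (x : galoisCohomology (ρ.toLocal (Sum.inl w)) 1), x ∈ 𝓕 (Sum.inl w))
    (inv : LocalInvariants K (p ^ k)) (hinv : ∀ v : HeightOneSpectrum (𝓞 K), Injective (inv (Sum.inr v)))
    (Ψ : galoisCohomology ρ 1 →+ galoisCohomology (ρ.tateDual (p ^ k)) 1)
    (hΨ : ∀ (φ : contOneCocycles ρ.toTopRep) (ψ : contOneCocycles (ρ.tateDual (p ^ k)).toTopRep),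
      (∀ g, ψ.1 g = (D.toTateDual lam hlam exp hexp).toContinuousLinearMap.toLinearMap.toAddMonoidHom (φ.1 (cd.conj g))) → Ψ (oneCocycleClass _ φ) = oneCocycleClass _ ψ)
    {c' : galoisCohomology (ρ.tateDual (p ^ k)) 1} (hc' : c' ∈ (inv.dualSelmerStructure ρ 𝓕).selmerGroup) :
    ∃ c ∈ 𝓕.selmerGroup, Ψ c = c' := by
  -- the `τ`-semilinear inverse `Θ'` of `Θ` and the inverse transfer `Ψ'`
  let Θe : M ≃+ TateDual K M (p ^ k) := AddEquiv.ofBijective (D.toTateDual lam hlam exp hexp).toContinuousLinearMap.toLinearMap.toAddMonoidHom hΘ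
  have hΘ' : ∀ (g : absoluteGaloisGroup K) (m' : TateDual K M (p ^ k)),
      (Θe.symm : TateDual K M (p ^ k) →+ M) ((ρ.tateDual (p ^ k)) (cd.conj g) m') = ρ g ((Θe.symm : _ →+ M) m') := by
    intro g m'
    apply hΘ.1
    change (D.toTateDual lam hlam exp hexp).toContinuousLinearMap.toLinearMap.toAddMonoidHom (Θe.symm _) = (D.toTateDual lam hlam exp hexp).toContinuousLinearMap.toLinearMap.toAddMonoidHom (ρ g (Θe.symm m'))
    have h1 : (D.toTateDual lam hlam exp hexp).toContinuousLinearMap.toLinearMap.toAddMonoidHom (Θe.symm ((ρ.tateDual (p ^ k)) (cd.conj g) m')) = (ρ.tateDual (p ^ k)) (cd.conj g) m' :=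
      Θe.apply_symm_apply _
    have h2 := D.toTateDual_semilinear lam hlam exp hexp (cd.conj g) (Θe.symm m')
    rw [conj_conj'] at h2
    rw [h1, h2]
    exact congrArg _ (Θe.apply_symm_apply m').symm
  obtain ⟨Ψ', hΨ'⟩ := exists_conjTransfer cd (ρ.tateDual (p ^ k)) ρ (Θe.symm : TateDual K M (p ^ k) →+ M) hΘ'
  have hinvΘ : ∀ m, (Θe.symm : TateDual K M (p ^ k) →+ M) ((D.toTateDual lam hlam exp hexp).toContinuousLinearMap.toLinearMap.toAddMonoidHom m) = m := fun m => Θe.symm_apply_apply m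
  refine ⟨Ψ' c', ?_, conjTransfer_conjTransfer_eq_self cd (ρ.tateDual (p ^ k)) ρ (Θe.symm : _ →+ M) (D.toTateDual lam hlam exp hexp).toContinuousLinearMap.toLinearMap.toAddMonoidHom hΘ'
    (D.toTateDual_semilinear lam hlam exp hexp) (fun m' => Θe.apply_symm_apply m') Ψ' hΨ' Ψ hΨ c'⟩
  -- `Ψ' c'` is an `𝓕`-Selmer class: read `loc_u (Ψ (Ψ' c')) = loc_u c' ∈ 𝓕_u^* = Θ_*(transport_u 𝓕_{σ u})` at `u = σ w`
  have hΨc : Ψ (Ψ' c') = c' := conjTransfer_conjTransfer_eq_self cd (ρ.tateDual (p ^ k)) ρ (Θe.symm : _ →+ M) (D.toTateDual lam hlam exp hexp).toContinuousLinearMap.toLinearMap.toAddMonoidHom hΘ'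
    (D.toTateDual_semilinear lam hlam exp hexp) (fun m' => Θe.apply_symm_apply m') Ψ' hΨ' Ψ hΨ c'
  rw [SelmerStructure.mem_selmerGroup_iff]
  have key : ∀ u : HeightOneSpectrum (𝓞 K),
      galoisCohomology.localization ρ (Sum.inr (cd.σ • u)) 1 (Ψ' c') ∈ 𝓕 (Sum.inr (cd.σ • u)) := by
    intro u
    have hu := (SelmerStructure.mem_selmerGroup_iff _ _).1 hc' (Sum.inr u)
    rw [LocalInvariants.dualSelmerStructure_apply, ← hΨc,
      conjTransfer_localization cd ρ (ρ.tateDual (p ^ k)) _ (D.toTateDual_semilinear lam hlam exp hexp) Ψ hΨ u,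
      ← D.map_toTateDual_transportH1_eq_dualLocalCondition lam hlam exp hexp hρ hR hexpb hfrob hΘ 𝓕 hso h𝓕R inv hinv u]
      at hu
    obtain ⟨y, hy, he⟩ := hu
    have h1 : cd.transportH1 ρ u y =
        cd.transportH1 ρ u (galoisCohomology.localization ρ (Sum.inr (cd.σ • u)) 1 (Ψ' c')) :=
      (bijective_cohomologyMap_of_bijective ((cd.twist ρ).toLocal (Sum.inr u)) ((ρ.tateDual (p ^ k)).toLocal (Sum.inr u))
        (D.toTateDual lam hlam exp hexp).toContinuousLinearMap.toLinearMap.toAddMonoidHom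
        (twist_semilinear_equivariant_toLocal cd ρ (ρ.tateDual (p ^ k)) _
          (D.toTateDual_semilinear lam hlam exp hexp) (Sum.inr u)) hΘ).1 he
    have h2 : y = galoisCohomology.localization ρ (Sum.inr (cd.σ • u)) 1 (Ψ' c') :=
      cd.transportH1_injective ρ u h1
    rw [← h2]
    exact hy
  rintro (w | w)
  · exact hinf𝓕 w _
  · have h := key (cd.σ • w)
    rwa [ConjugationDatum.smul_smul_place] at h

/-- **THE DUAL SLOT `Ψ : H¹_𝓕(K, T) ≃ H¹_{𝓕^*}(K, T^∨(1))`** (Howard: «we may identify `H¹_{𝓕*}(K, T*[𝔪]) ≅ H¹_𝓕(K, T[𝔪])`»):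
for a duality datum over a finite coefficient ring killed by `p^k`, read through a Frobenius character `λ` and a bijective
trivialisation `exp` with `Θ = toTateDual` bijective, and a self-orthogonal (H.4) structure `𝓕` with `R`-stable local
conditions, total at the infinite places (as is its dual), the transfer `Ψ` along `Θ` restricts to an additive BIJECTION of the
Selmer groups, for any family `inv` injective at the finite places.
[cite: Howard2004HeegnerKolyvagin, Thm. 1.4.2 proof (arXiv:1202.6340 p0008 L120–124) with §1.3 H.4 (p. 7 L69–82) and Def. 1.1.6] [cite: MilneADT2006, Ch. I Cor. 2.3] -/
theorem exists_addEquiv_selmerGroup_dualSelmerGroup [Finite R] (hρ : ρ.IsScalarLinear R)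
    (hR : ∀ r : R, p ^ k • r = 0) (hexpb : Bijective exp)
    (hfrob : Bijective ((AddMonoidHom.mul : R →+ R →+ R).compr₂ lam))
    (hΘ : Bijective (D.toTateDual lam hlam exp hexp))
    (𝓕 : SelmerStructure ρ) (hso : D.IsSelfOrthogonal 𝓕)
    (h𝓕R : ∀ (v : HeightOneSpectrum (𝓞 K)) (r : R) (x : galoisCohomology (ρ.toLocal (Sum.inr v)) 1),
      x ∈ 𝓕 (Sum.inr v) →
        galoisCohomology.scalarMapH1 (ρ.toLocal (Sum.inr v)) (isScalarLinear_toLocal hρ (Sum.inr v)) r x ∈ 𝓕 (Sum.inr v))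
    (hinf𝓕 : ∀ (w : InfinitePlace K) (x : galoisCohomology (ρ.toLocal (Sum.inl w)) 1), x ∈ 𝓕 (Sum.inl w))
    (inv : LocalInvariants K (p ^ k)) (hinv : ∀ v : HeightOneSpectrum (𝓞 K), Injective (inv (Sum.inr v)))
    (hinf : ∀ (w : InfinitePlace K) (x : galoisCohomology ((ρ.tateDual (p ^ k)).toLocal (Sum.inl w)) 1),
      x ∈ inv.dualSelmerStructure ρ 𝓕 (Sum.inl w))
    (Ψ : galoisCohomology ρ 1 →+ galoisCohomology (ρ.tateDual (p ^ k)) 1)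
    (hΨ : ∀ (φ : contOneCocycles ρ.toTopRep) (ψ : contOneCocycles (ρ.tateDual (p ^ k)).toTopRep),
      (∀ g, ψ.1 g = (D.toTateDual lam hlam exp hexp).toContinuousLinearMap.toLinearMap.toAddMonoidHom (φ.1 (cd.conj g))) → Ψ (oneCocycleClass _ φ) = oneCocycleClass _ ψ) :
    ∃ e : ↥𝓕.selmerGroup ≃+ ↥(inv.dualSelmerStructure ρ 𝓕).selmerGroup,
      ∀ c : ↥𝓕.selmerGroup, ((e c : ↥(inv.dualSelmerStructure ρ 𝓕).selmerGroup) :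
        galoisCohomology (ρ.tateDual (p ^ k)) 1) = Ψ c := by
  -- the inverse transfer (for injectivity of `Ψ`)
  let Θe : M ≃+ TateDual K M (p ^ k) := AddEquiv.ofBijective (D.toTateDual lam hlam exp hexp).toContinuousLinearMap.toLinearMap.toAddMonoidHom hΘ
  have hΘ' : ∀ (g : absoluteGaloisGroup K) (m' : TateDual K M (p ^ k)),
      (Θe.symm : TateDual K M (p ^ k) →+ M) ((ρ.tateDual (p ^ k)) (cd.conj g) m') = ρ g ((Θe.symm : _ →+ M) m') := by
    intro g m'
    apply hΘ.1
    change (D.toTateDual lam hlam exp hexp).toContinuousLinearMap.toLinearMap.toAddMonoidHom (Θe.symm _) = (D.toTateDual lam hlam exp hexp).toContinuousLinearMap.toLinearMap.toAddMonoidHom (ρ g (Θe.symm m'))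
    have h1 : (D.toTateDual lam hlam exp hexp).toContinuousLinearMap.toLinearMap.toAddMonoidHom (Θe.symm ((ρ.tateDual (p ^ k)) (cd.conj g) m')) = (ρ.tateDual (p ^ k)) (cd.conj g) m' :=
      Θe.apply_symm_apply _
    have h2 := D.toTateDual_semilinear lam hlam exp hexp (cd.conj g) (Θe.symm m')
    rw [conj_conj'] at h2
    rw [h1, h2]
    exact congrArg _ (Θe.apply_symm_apply m').symm
  obtain ⟨Ψ', hΨ'⟩ := exists_conjTransfer cd (ρ.tateDual (p ^ k)) ρ (Θe.symm : TateDual K M (p ^ k) →+ M) hΘ'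
  have hbij : Bijective Ψ := conjTransfer_bijective cd ρ (ρ.tateDual (p ^ k)) (D.toTateDual lam hlam exp hexp).toContinuousLinearMap.toLinearMap.toAddMonoidHom (Θe.symm : _ →+ M)
    (D.toTateDual_semilinear lam hlam exp hexp) hΘ' (fun m => Θe.symm_apply_apply m) (fun m' => Θe.apply_symm_apply m')
    Ψ hΨ Ψ' hΨ'
  let φ : ↥𝓕.selmerGroup →+ ↥(inv.dualSelmerStructure ρ 𝓕).selmerGroup :=
    AddMonoidHom.mk' (fun c => ⟨Ψ c.1, D.conjTransfer_mem_dualSelmerGroup lam hlam exp hexp 𝓕 hso inv hinf Ψ hΨ c.2⟩)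
      (fun a b => Subtype.ext (map_add Ψ a.1 b.1))
  have hφ : ∀ c, (φ c).1 = Ψ c.1 := fun _ => rfl
  have hφinj : Injective φ := fun a b hab =>
    Subtype.ext (hbij.1 ((hφ a).symm.trans ((congrArg Subtype.val hab).trans (hφ b))))
  have hφsurj : Surjective φ := by
    intro c'
    obtain ⟨c, hc, hcc'⟩ := D.exists_mem_selmerGroup_conjTransfer_eq lam hlam exp hexp hρ hR hexpb hfrob hΘ 𝓕 hso h𝓕R hinf𝓕
      inv hinv Ψ hΨ c'.2
    exact ⟨⟨c, hc⟩, Subtype.ext ((hφ _).trans hcc')⟩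
  exact ⟨AddEquiv.ofBijective φ ⟨hφinj, hφsurj⟩, fun c => hφ c⟩

end DualityDatum

end Literature.NumberTheory.GaloisCohomology.Howard2004

end
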